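import Literature.ModelTheory.Quasiminimal.ContinuumStrong
import Literature.NumberTheory.Transcendental.AxiomFourTransfer
import HarnessLib

/-!
# Axiom 4 (strong exponential-algebraic closedness over the base) for the continuum model

Bays–Kirby 2018, Thm 8.2 (4) / Thm 9.1 (4): for every irreducible closed `W ⊆ 𝔾ⁿ(F)` which is
free and rotund of dimension `n` and every finite `A ⊆ F` there is `z ∈ W ∩ graph(exp)` no
nontrivial `ℤ`-combination of whose additive coordinates lies in the `ℚ`-span of the base and
`A`. We show that this property passes from the countable chart `M` to the continuum model
`F = S.F` of `ContinuumModel.lean` ("axiom 4 is preserved under unions of directed systems of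
closed embeddings", B–K proof of Thm 8.2): a closed `W` is cut out by finitely many
polynomials (Hilbert's basis theorem), whose coefficients — together with `A` — lie in one chart
`[M]_{Z₀}`; by `AxiomFourTransfer.lean` the `M`-points of `W` form a variety to which all the
hypotheses descend; a solution there is pushed forward along the E-field embedding
`[·]_{Z₀}`, and the independence condition pulls back because `[·]_{Z₀}` is injective and
`ℚ`-linear and fixes the base.

## References

* M. Bays, J. Kirby, *Pseudo-exponential maps, variants, and quasiminimality*, Algebra & Number
  Theory 12 (2018), Thm 8.2 (4) and its proof.
-/

noncomputable section

suppress_compilation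

open Set MvPolynomial
open Literature.ModelTheory.ExponentialFields Literature.NumberTheory.Transcendental
open Literature.NumberTheory.Transcendental.ChartTransfer

namespace Literature.ModelTheory.Quasiminimal

namespace Setup

open FirstOrder FirstOrder.Language

variable {L : Language.{0, 0}} {M : Type} [L.Structure M] [Field M] [ExponentialRing M]
  {cl : Set M → Set M} (S : Setup L M cl)

/-- A closed subset of `F^{n ⊕ n}` is cut out by finitely many polynomials with coefficients in
one chart. [folklore] -/
theorem exists_chart_definedOver {n : ℕ} {W : Set (Fin n ⊕ Fin n → S.F)}
    (hW : IsZariskiClosed S.F W) (A : Finset S.F) :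
    ∃ (Z₀ : Finset ℝ) (G : Set (MvPolynomial (Fin n ⊕ Fin n) M)) (AM : Finset M),
      (letI : Algebra M S.F := (S.of Z₀).toAlgebra
       W = zeroLocus S.F (Ideal.span G)) ∧ (A : Set S.F) = S.of Z₀ '' ↑AM := by
  classical
  obtain ⟨I, hI⟩ := hW
  -- finitely many generators
  obtain ⟨GF, hGF⟩ := (isNoetherianRing_iff_ideal_fg _).1
    (inferInstance : IsNoetherianRing (MvPolynomial (Fin n ⊕ Fin n) S.F)) I
  -- one chart for all coefficients and `A`
  obtain ⟨Z₀, t, ht⟩ := S.exists_chart_finset (GF.biUnion MvPolynomial.coeffs ∪ A)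
  have hcoef : ∀ g ∈ GF, (↑g.coeffs : Set S.F) ⊆ Set.range (S.of Z₀) := by
    intro g hg c hc
    have : c ∈ ((GF.biUnion MvPolynomial.coeffs ∪ A : Finset S.F) : Set S.F) :=
      Finset.mem_coe.2 (Finset.mem_union_left _ (Finset.mem_biUnion.2 ⟨g, hg, hc⟩))
    rw [ht] at this
    obtain ⟨m, -, hm⟩ := this
    exact ⟨m, hm⟩
  have hAim : ∀ a ∈ A, ∃ m ∈ t, S.of Z₀ m = a := by
    intro a ha
    have : a ∈ ((GF.biUnion MvPolynomial.coeffs ∪ A : Finset S.F) : Set S.F) :=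
      Finset.mem_coe.2 (Finset.mem_union_right _ ha)
    rw [ht] at this
    obtain ⟨m, hm, hma⟩ := this
    exact ⟨m, hm, hma⟩
  letI : Algebra M S.F := (S.of Z₀).toAlgebra
  have halg : algebraMap M S.F = S.of Z₀ := rfl
  -- lift the generators
  have hlift : ∀ g : GF, ∃ g' : MvPolynomial (Fin n ⊕ Fin n) M,
      MvPolynomial.map (algebraMap M S.F) g' = g := by
    intro g
    have : (g : MvPolynomial (Fin n ⊕ Fin n) S.F) ∈ Set.range (MvPolynomial.map (algebraMap M S.F)) := by
      rw [mem_range_map_iff_coeffs_subset]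
      exact hcoef g g.2
    exact this
  choose lift hlift' using hlift
  -- preimages of `A`
  choose pre hpre hpre' using hAim
  refine ⟨Z₀, Set.range lift, A.attach.image fun a => pre a.1 a.2, ?_, ?_⟩
  · rw [hI, ← hGF, zeroLocus_span, zeroLocus_span]
    ext x
    simp only [mem_setOf_eq, Finset.mem_coe, Set.mem_range]
    constructor
    · rintro hx _ ⟨g, rfl⟩
      rw [← aeval_map_algebraMap S.F, hlift']
      exact hx g g.2
    · intro hx g hg
      have := hx (lift ⟨g, hg⟩) ⟨⟨g, hg⟩, rfl⟩
      rwa [← aeval_map_algebraMap S.F, hlift'] at this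
  · ext a
    simp only [Finset.coe_image, mem_image, Finset.mem_coe, Finset.mem_attach, true_and,
      Subtype.exists]
    constructor
    · intro ha
      exact ⟨_, ⟨a, ha, rfl⟩, hpre' a ha⟩
    · rintro ⟨_, ⟨b, hb, rfl⟩, rfl⟩
      rw [hpre' b hb]; exact hb

variable {K : Type} [Field K] (ιM : K →+* M)
  (hfix : ∀ σ : M → M, IsQFEmbOn L σ Set.univ → ∀ k, σ (ιM k) = ιM k)

include hfix in
/-- **Axiom 4 transfers to the continuum model.** If the chart `M` is algebraically closed and
satisfies Bays–Kirby's strong exponential-algebraic closedness over the base `ιM[D]`, then so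
does `F = S.F` over `ιF[D]`. [cite: BaysKirby2018ANT, Thm 8.2 (4) (proof)] -/
theorem axiom4_F [CharZero M] [IsAlgClosed M] (D : Set K)
    (h4 : ∀ (n : ℕ) (W : Set (Fin n ⊕ Fin n → M)), IsIrreducibleClosed M W →
      (W ∩ torusLocus M n).Nonempty → IsRotund M n (W ∩ torusLocus M n) →
      IsAddFree M n (W ∩ torusLocus M n) → IsMulFree M n (W ∩ torusLocus M n) →
      zariskiDim M W = n →
      ∀ A : Finset M, ∃ z ∈ W ∩ expGraph M n,
        ∀ m : Fin n → ℤ, (∑ i, (m i : M) * z (Sum.inl i)) ∈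
          Submodule.span ℚ (ιM '' D ∪ ↑A) → m = 0) :
    ∀ (n : ℕ) (W : Set (Fin n ⊕ Fin n → S.F)), IsIrreducibleClosed S.F W →
      (W ∩ torusLocus S.F n).Nonempty → IsRotund S.F n (W ∩ torusLocus S.F n) →
      IsAddFree S.F n (W ∩ torusLocus S.F n) → IsMulFree S.F n (W ∩ torusLocus S.F n) →
      zariskiDim S.F W = n →
      ∀ A : Finset S.F, ∃ z ∈ W ∩ expGraph S.F n,
        ∀ m : Fin n → ℤ, (∑ i, (m i : S.F) * z (Sum.inl i)) ∈
          Submodule.span ℚ (S.ιF ιM '' D ∪ ↑A) → m = 0 := by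
  classical
  haveI : IsAlgClosed S.F := S.isAlgClosed_F
  intro n W hW hne hrot hadd hmul hdim A
  obtain ⟨Z₀, G, AM, hWG, hA⟩ := S.exists_chart_definedOver hW.1 A
  letI : Algebra M S.F := (S.of Z₀).toAlgebra
  have halg : algebraMap M S.F = S.of Z₀ := rfl
  -- the variety of `M`-points and its properties
  set WM : Set (Fin n ⊕ Fin n → M) := zeroLocus M (contract (M := M) (vanishingIdeal S.F W))
    with hWM
  have h1 : IsIrreducibleClosed M WM := isIrreducibleClosed_zeroLocus_contract hW
  have h2 : (WM ∩ torusLocus M n).Nonempty := nonempty_zeroLocus_contract_inter_torus hW hne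
  have h3 : IsRotund M n (WM ∩ torusLocus M n) := isRotund_zeroLocus_contract hW hWG hne hrot
  have h4a : IsAddFree M n (WM ∩ torusLocus M n) := isAddFree_zeroLocus_contract hW hadd
  have h4m : IsMulFree M n (WM ∩ torusLocus M n) := isMulFree_zeroLocus_contract hW hmul
  have h5 : zariskiDim M WM = n := by rw [hWM, zariskiDim_zeroLocus_contract hW hWG, hdim]
  -- solve in `M`
  obtain ⟨zt, ⟨hzW, hzexp⟩, hzind⟩ := h4 n WM h1 h2 h3 h4a h4m h5 AM
  refine ⟨S.of Z₀ ∘ zt, ⟨?_, ?_⟩, fun m hm => hzind m ?_⟩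
  · exact (mem_zeroLocus_contract_iff hWG zt).1 hzW
  · intro i
    simp only [Function.comp_apply]
    rw [hzexp i, S.exp_of]
  · -- pull the linear condition back along the injective `ℚ`-linear chart map
    set j := GammaField.linearOf (S.ofExp Z₀) with hj
    have hjof : ∀ x, j x = S.of Z₀ x := fun x => rfl
    have hspan : Submodule.span ℚ (S.ιF ιM '' D ∪ ↑A) =
        (Submodule.span ℚ (ιM '' D ∪ ↑AM)).map j := by
      rw [Submodule.map_span, Set.image_union, hA, Set.image_image]
      congr 2
      exact Set.image_congr fun x _ => by rw [hjof, S.of_ιM ιM hfix Z₀ x]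
    have hsum : (∑ i, (m i : S.F) * (S.of Z₀ ∘ zt) (Sum.inl i)) =
        j (∑ i, (m i : M) * zt (Sum.inl i)) := by
      rw [hjof, map_sum]
      refine Finset.sum_congr rfl fun i _ => ?_
      rw [map_mul, map_intCast, Function.comp_apply]
    rw [hspan, hsum] at hm
    obtain ⟨y, hy, hyx⟩ := Submodule.mem_map.1 hm
    rwa [← GammaField.linearOf_injective (S.ofExp Z₀) hyx]

end Setup

end Literature.ModelTheory.Quasiminimal

end
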